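import Summits.PneNP.PneNP.Theses.KarlinRubin
import Summits.PneNP.PneNP.Theorems.PlantedCliqueErdosRenyiNoLargeClique
import Literature.Computability.Complexity.CircuitLowerBoundsProofs

/-!
# `MonotoneBlind` (stmt-PneNP-18027, route PneNP/KarlinRubin, crux #3) — negative-side lemmas: load-bearing hypotheses

Birth-vetting (crux-attack) output for the crux `Summit.PneNP.PneNP.Theses.KarlinRubin.MonotoneBlind`:
`∀ δ ∈ (0,1/2), ∀ c, ¬ ∃` a family `C n` of circuits over `{∧₂, ∨₂, 0, 1}` of size `≤ n^c` eventually with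
`Pr_{G(n,1/2)}[C n = 1] + Pr_{G(n,1/2,⌈n^{1/2-δ}⌉)}[C n = 0] → 0`.
The crux is NOT refuted and NOT mis-stated (it is the monotone shadow of the non-uniform planted-clique
conjecture; neither `MonotoneBlind → PneNP` nor `PneNP → MonotoneBlind` is in sight). This file records,
as theorems, which restriction carries the weight and what a kill must deliver:

* §0 `not_monotoneBlind_iff` — the negation pushed through: a kill is ONE `δ ∈ (0,1/2)`, ONE exponent `c`
  and a monotone family of size `≤ n^c` eventually whose error sum tends to `0`.
* §1 `exists_monotone_strongDetector` — for EVERY exponent `0 < ε ≤ 1` (so every `k = ⌈n^{1/2-δ}⌉`,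
  `δ ∈ (0,1/2)`) a MONOTONE family of QUASI-POLYNOMIAL size `≤ n^{3⌊log₂ n⌋ + 5}` strongly detects the
  planted `⌈n^ε⌉`-clique: the brute-force clique test `CLIQUE(n, 3⌊log₂ n⌋ + 3)` as an OR of ANDs with its
  gate count (`exists_monotone_computes_cliqueFn_sized`, the sized form of the tree's
  `exists_monotone_computes_cliqueFn_holds`); its type-II error is `0` eventually (the planted set contains
  a `t(n)`-clique) and its type-I error `→ 0` by the first-moment bound
  `plantedClique_erdosRenyiNoLargeClique_proof` (stmt-PneNP-8686). So the room the crux lives in is exactly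
  polynomial `n^c` versus quasi-polynomial `n^{O(log n)}` (conjectured truth `n^{Θ(δ log n)}`). Hence
  `monotoneBlind_false_without_sizeBound` (and `withoutSizeBound_fails_everywhere`): the polynomial SIZE
  bound is load-bearing at every `δ` — the distribution pair is perfectly distinguishable inside the
  monotone world, so any proof of the crux is a genuine monotone SIZE lower bound, not an
  information-theoretic or monotonicity obstruction.
* §2 `monotoneBlind_false_without_errorClause`, `errSum_const_false` — the size/basis constraint alone is
  met by the one-gate constant circuit (error sum identically `1`), so the error clause is (trivially)
  load-bearing as well; §1–§2 together are the non-vacuity audit of the crux (each conjunct of the negated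
  existential is separately satisfiable; jointly they are the open question).

Refuter seat refuter-rattack-stmt-PneNP-18027-0 (crux-attack at birth, gen 1), 2026-08-17.
-/

set_option linter.dupNamespace false

namespace Summit.PneNP.PneNP.Theorems.MonotoneBlind.Negative

open Literature.Computability.Complexity Literature.Probability.RandomGraphs.PlantedClique Filter Finset GateList
open Summit.PneNP.PneNP.Theses.KarlinRubin (MonotoneBlind)

/-! ## §0 What a kill must deliver -/

/-- **Negation pushed through.** `¬ MonotoneBlind` is: some `δ ∈ (0,1/2)`, some exponent `c` and some
monotone family of size `≤ n^c` eventually with error sum `→ 0`. [folklore] -/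
theorem not_monotoneBlind_iff :
    ¬ MonotoneBlind ↔ ∃ δ : ℝ, 0 < δ ∧ δ < 1 / 2 ∧ ∃ c : ℕ,
      ∃ C : (n : ℕ) → Circuit ((⊤ : SimpleGraph (Fin n)).edgeSet),
        (∀ᶠ n : ℕ in atTop, (C n).IsOver monotoneBasis01 ∧ (C n).size ≤ n ^ c) ∧
          Tendsto (fun n : ℕ => (erdosRenyiHalf n).toOuterMeasure {x | (C n).eval x = true} +
            (plantedCliqueDist n ⌈(n : ℝ) ^ (1 / 2 - δ)⌉₊).toOuterMeasure {x | (C n).eval x = false})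
            atTop (nhds 0) := by
  simp only [MonotoneBlind, not_forall, not_not, exists_prop]

/-! ## §1 The size bound is load-bearing: brute force detects, monotonically -/

/-- `t(n) = 3⌊log₂ n⌋ + 3 ≥ 3 log₂ n` (so the first-moment bound applies with `η = 1`). [folklore] -/
theorem three_logb_le_tLog (n : ℕ) : (2 + 1) * Real.logb 2 (n : ℝ) ≤ ((3 * Nat.log 2 n + 3 : ℕ) : ℝ) := by
  rcases Nat.eq_zero_or_pos n with hn | hn
  · subst hn
    simp
  · have hlt : (n : ℝ) < (2 : ℝ) ^ ((Nat.log 2 n + 1 : ℕ) : ℝ) := by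
      rw [Real.rpow_natCast]
      exact_mod_cast Nat.lt_pow_succ_log_self (by norm_num : 1 < 2) n
    have hlogb : Real.logb 2 (n : ℝ) < ((Nat.log 2 n + 1 : ℕ) : ℝ) :=
      (Real.logb_lt_iff_lt_rpow (by norm_num) (by exact_mod_cast hn)).2 hlt
    have : ((3 * Nat.log 2 n + 3 : ℕ) : ℝ) = 3 * ((Nat.log 2 n + 1 : ℕ) : ℝ) := by
      push_cast; ring
    rw [this]
    linarith

/-- `t(n) ≤ ⌈n^ε⌉` and `t(n) ≤ n` eventually, for every `0 < ε ≤ 1`. [folklore] -/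
theorem tLog_le_eventually {ε : ℝ} (hε : 0 < ε) (hε1 : ε ≤ 1) :
    ∀ᶠ n : ℕ in atTop, 3 * Nat.log 2 n + 3 ≤ ⌈(n : ℝ) ^ ε⌉₊ ∧ 3 * Nat.log 2 n + 3 ≤ n := by
  have h1 : Tendsto (fun n : ℕ => Real.log (n : ℝ) / (n : ℝ) ^ ε) atTop (nhds 0) :=
    ((isLittleO_log_rpow_atTop hε).comp_tendsto tendsto_natCast_atTop_atTop).tendsto_div_nhds_zero
  have h2 : ∀ᶠ n : ℕ in atTop, Real.log (n : ℝ) / (n : ℝ) ^ ε < Real.log 2 / 6 :=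
    h1.eventually (gt_mem_nhds (by positivity))
  have h3 : ∀ᶠ n : ℕ in atTop, (6 : ℝ) ≤ (n : ℝ) ^ ε :=
    ((tendsto_rpow_atTop hε).comp tendsto_natCast_atTop_atTop).eventually_ge_atTop 6
  filter_upwards [h2, h3, eventually_ge_atTop 1] with n h2 h3 hn1
  have hnpos : (0 : ℝ) < n := by exact_mod_cast hn1
  have hrpos : 0 < (n : ℝ) ^ ε := Real.rpow_pos_of_pos hnpos _
  have hlog2 : 0 < Real.log 2 := Real.log_pos one_lt_two
  have hnat : ((Nat.log 2 n : ℕ) : ℝ) ≤ Real.logb 2 (n : ℝ) := by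
    rw [Real.le_logb_iff_rpow_le (by norm_num) hnpos, Real.rpow_natCast]
    exact_mod_cast Nat.pow_log_le_self 2 (by omega)
  have hlogb_le : Real.logb 2 (n : ℝ) ≤ (n : ℝ) ^ ε / 6 := by
    rw [Real.logb, div_le_div_iff₀ hlog2 (by norm_num : (0:ℝ) < 6)]
    have := (div_lt_iff₀ hrpos).1 h2
    nlinarith
  have hreal : ((3 * Nat.log 2 n + 3 : ℕ) : ℝ) ≤ (n : ℝ) ^ ε := by
    push_cast
    nlinarith
  constructor
  · have : ((3 * Nat.log 2 n + 3 : ℕ) : ℝ) ≤ (⌈(n : ℝ) ^ ε⌉₊ : ℝ) := hreal.trans (Nat.le_ceil _)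
    exact_mod_cast this
  · have hle : (n : ℝ) ^ ε ≤ n := by
      conv_rhs => rw [← Real.rpow_one (n : ℝ)]
      exact Real.rpow_le_rpow_of_exponent_le (by exact_mod_cast hn1) hε1
    exact_mod_cast hreal.trans hle

/-- **OR of ANDs, with its size.** For `2 ≤ s ≤ m`, `CLIQUE(m, s)` has a monotone `{∧₂, ∨₂}`-circuit with at
most `C(m, s) · (C(m, 2) + 1)` gates: one AND-chain over the `C(s,2) ≤ C(m,2)` edges of each `s`-set, then one
OR-chain over the `C(m, s)` results (the construction of `exists_monotone_computes_cliqueFn_holds`, which forgets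
the size). [AlonBoppana1987 §3] [folklore] -/
theorem exists_monotone_computes_cliqueFn_sized {m s : ℕ} (h2 : 2 ≤ s) (hsm : s ≤ m) :
    ∃ C : Circuit ((⊤ : SimpleGraph (Fin m)).edgeSet), C.IsOver monotoneBasis ∧
      C.size ≤ m.choose s * (m.choose 2 + 1) ∧ C.Computes (cliqueFn m s) := by
  classical
  set T : Finset (Finset (Fin m)) := powersetCard s univ with hT
  let E : Finset (Fin m) → List ((⊤ : SimpleGraph (Fin m)).edgeSet) := fun S =>
    (univ.filter fun e => IsLive S e).toList
  have hEne : ∀ S ∈ T, E S ≠ [] := by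
    intro S hS
    have hScard : #S = s := (mem_powersetCard.1 hS).2
    obtain ⟨u, hu, v, hv, huv⟩ := one_lt_card.1 (by omega : 1 < #S)
    have he : s(u, v) ∈ (⊤ : SimpleGraph (Fin m)).edgeSet := (SimpleGraph.mem_edgeSet _).2 huv
    intro hnil
    have : (⟨s(u, v), he⟩ : (⊤ : SimpleGraph (Fin m)).edgeSet) ∈ E S :=
      Finset.mem_toList.2 (mem_filter.2 ⟨mem_univ _, (isLive_mk he).2 ⟨hu, hv⟩⟩)
    rw [hnil] at this
    simp at this
  have hTne : T.toList ≠ [] := by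
    intro hnil
    have hne : T.Nonempty := powersetCard_nonempty.2 (by simpa using hsm)
    obtain ⟨S, hS⟩ := hne
    have := Finset.mem_toList.2 hS
    rw [hnil] at this
    simp at this
  -- stage 1: all the ANDs in parallel
  have h1 : CktSize monotoneBasis
      (fun (x : (⊤ : SimpleGraph (Fin m)).edgeSet → Bool) (S : T) => (E S).all fun e => x e)
      (∑ S : T, (E S).length) :=
    CktSize.pi fun S => cktSize_all (E S) (hEne S S.2)
  -- stage 2: the OR of the results
  have hUne : (univ : Finset T).toList ≠ [] := by
    intro hnil
    obtain ⟨S, hS⟩ := List.exists_mem_of_ne_nil T.toList hTne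
    have := Finset.mem_toList.2 (mem_univ (⟨S, Finset.mem_toList.1 hS⟩ : T))
    rw [hnil] at this
    simp at this
  have h2 := h1.comp (cktSize_any (ι := T) (univ : Finset T).toList hUne)
  obtain ⟨C, hCB, hs, hCev⟩ := h2.toCircuit
  refine ⟨C, hCB, hs.trans ?_, fun x => ?_⟩
  · -- size bookkeeping
    have hcardT : Fintype.card T = m.choose s := by
      rw [Fintype.card_coe, hT, card_powersetCard, card_univ, Fintype.card_fin]
    have hE : ∀ S : T, (E S).length ≤ m.choose 2 := fun S => by
      simp only [E, Finset.length_toList]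
      calc #(univ.filter fun e => IsLive S.1 e) ≤ #(univ : Finset ((⊤ : SimpleGraph (Fin m)).edgeSet)) :=
            card_filter_le _ _
        _ = m.choose 2 := by
            have h := SimpleGraph.card_edgeFinset_top_eq_card_choose_two (V := Fin m)
            rwa [SimpleGraph.edgeFinset_card, Fintype.card_fin, ← card_univ] at h
    have hsum : ∑ S : T, (E S).length ≤ m.choose s * m.choose 2 := by
      calc ∑ S : T, (E S).length ≤ ∑ _S : T, m.choose 2 := sum_le_sum fun S _ => hE S
        _ = m.choose s * m.choose 2 := by rw [sum_const, card_univ, hcardT, smul_eq_mul]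
    have hlen : (univ : Finset T).toList.length = m.choose s := by
      rw [Finset.length_toList, card_univ, hcardT]
    rw [hlen, mul_add, mul_one]
    exact Nat.add_le_add_right hsum _
  rw [hCev]
  -- the OR of ANDs is the clique function
  apply Bool.eq_iff_iff.2
  rw [cliqueFn_eq_true_iff_exists, List.any_eq_true]
  constructor
  · rintro ⟨S, -, hS⟩
    rw [List.all_eq_true] at hS
    refine ⟨S, (mem_powersetCard.1 S.2).2, fun e he => hS e ?_⟩
    exact Finset.mem_toList.2 (mem_filter.2 ⟨mem_univ _, he⟩)
  · rintro ⟨S, hS, hx⟩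
    have hST : S ∈ T := mem_powersetCard.2 ⟨subset_univ _, hS⟩
    refine ⟨⟨S, hST⟩, Finset.mem_toList.2 (mem_univ _), ?_⟩
    rw [List.all_eq_true]
    intro e he
    exact hx e (mem_filter.1 (Finset.mem_toList.1 he)).2

/-- **§1 main.** For every exponent `0 < ε ≤ 1` a MONOTONE circuit family (the brute-force clique test
`CLIQUE(n, 3⌊log₂ n⌋ + 3)`, an OR of ANDs of size `n^{O(log n)}`, monotone over `{∧₂, ∨₂, 0, 1}` at EVERY `n`)
strongly detects the planted `⌈n^ε⌉`-clique in `G(n,1/2)`: type-I + type-II error `→ 0`.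
[AlonKrivelevichSudakov1998 §1 (exhaustive search succeeds above `2 log₂ n`)] [folklore] -/
theorem exists_monotone_strongDetector {ε : ℝ} (hε : 0 < ε) (hε1 : ε ≤ 1) :
    ∃ C : (n : ℕ) → Circuit ((⊤ : SimpleGraph (Fin n)).edgeSet), (∀ n, (C n).IsOver monotoneBasis01) ∧
      (∀ᶠ n : ℕ in atTop, (C n).size ≤ n ^ (3 * Nat.log 2 n + 5)) ∧
      Tendsto (fun n : ℕ => (erdosRenyiHalf n).toOuterMeasure {x | (C n).eval x = true} +
        (plantedCliqueDist n ⌈(n : ℝ) ^ ε⌉₊).toOuterMeasure {x | (C n).eval x = false}) atTop (nhds 0) := by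
  classical
  -- the family: brute-force `CLIQUE(n, t n)` where `t n ≤ n`, the constant `0` elsewhere (junk range)
  let t : ℕ → ℕ := fun n => 3 * Nat.log 2 n + 3
  have ht2 : ∀ n, 2 ≤ t n := fun n => by simp only [t]; omega
  let C : (n : ℕ) → Circuit ((⊤ : SimpleGraph (Fin n)).edgeSet) := fun n =>
    if h : t n ≤ n then (exists_monotone_computes_cliqueFn_sized (ht2 n) h).choose
    else Circuit.const _ false
  have hCover : ∀ n, (C n).IsOver monotoneBasis01 := by
    intro n
    by_cases h : t n ≤ n
    · have hC : C n = (exists_monotone_computes_cliqueFn_sized (ht2 n) h).choose := dif_pos h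
      rw [hC]
      exact (exists_monotone_computes_cliqueFn_sized (ht2 n) h).choose_spec.1.mono
        monotoneBasis_subset_monotoneBasis01
    · have hC : C n = Circuit.const _ false := dif_neg h
      rw [hC]
      intro g hg
      simp only [Circuit.const, List.mem_singleton] at hg
      subst hg
      exact Set.mem_insert_of_mem _ (Set.mem_insert _ _)
  have hCcomp : ∀ n, t n ≤ n → (C n).Computes (cliqueFn n (t n)) := by
    intro n h
    have hC : C n = (exists_monotone_computes_cliqueFn_sized (ht2 n) h).choose := dif_pos h
    rw [hC]
    exact (exists_monotone_computes_cliqueFn_sized (ht2 n) h).choose_spec.2.2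
  have hCsize : ∀ n, t n ≤ n → (C n).size ≤ n.choose (t n) * (n.choose 2 + 1) := by
    intro n h
    have hC : C n = (exists_monotone_computes_cliqueFn_sized (ht2 n) h).choose := dif_pos h
    rw [hC]
    exact (exists_monotone_computes_cliqueFn_sized (ht2 n) h).choose_spec.2.1
  have hgrow : ∀ᶠ n : ℕ in atTop, t n ≤ ⌈(n : ℝ) ^ ε⌉₊ ∧ t n ≤ n := tLog_le_eventually hε hε1
  refine ⟨C, hCover, ?_, ?_⟩
  · -- size `≤ C(n,t)·(C(n,2)+1) ≤ n^t · n^2` : quasi-polynomial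
    filter_upwards [hgrow, eventually_ge_atTop 1] with n hg hn1
    refine (hCsize n hg.2).trans ?_
    have hc2 : n.choose 2 + 1 ≤ n ^ 2 := by
      obtain ⟨k, rfl⟩ : ∃ k, n = k + 1 := ⟨n - 1, by omega⟩
      rw [Nat.choose_two_right]
      have h1 : (k + 1) * (k + 1 - 1) / 2 ≤ (k + 1) * k := by
        simpa using Nat.div_le_self ((k + 1) * k) 2
      have h2 : (k + 1) * k + 1 ≤ (k + 1) ^ 2 := by nlinarith
      omega
    calc n.choose (t n) * (n.choose 2 + 1) ≤ n ^ (t n) * n ^ 2 :=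
          Nat.mul_le_mul (Nat.choose_le_pow n (t n)) hc2
      _ = n ^ (3 * Nat.log 2 n + 5) := by rw [← pow_add]
  -- type I → 0 : `G(n,1/2)` has no `3 log₂ n`-clique w.h.p. (first moment, stmt-PneNP-8686)
  have hI : Tendsto (fun n : ℕ => (erdosRenyiHalf n).toOuterMeasure {x | (C n).eval x = true})
      atTop (nhds 0) := by
    have hE := Summit.PneNP.PneNP.Theorems.plantedClique_erdosRenyiNoLargeClique_proof t
      ⟨1, one_pos, Eventually.of_forall three_logb_le_tLog⟩
    refine hE.congr' ?_
    filter_upwards [hgrow] with n hn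
    congr 1
    ext x
    simp only [Set.mem_setOf_eq]
    rw [hCcomp n hn.2 x, cliqueFn_eq_true_iff]
    simp only [SimpleGraph.CliqueFree, not_forall, not_not]
    constructor
    · rintro ⟨S, h1, h2⟩
      exact ⟨S, ⟨h2, h1⟩⟩
    · rintro ⟨S, hS⟩
      exact ⟨S, hS.card_eq, hS.isClique⟩
  -- type II = 0 eventually : the planted set is a clique of size `⌈n^ε⌉ ≥ t n`
  have hII : ∀ᶠ n : ℕ in atTop,
      (plantedCliqueDist n ⌈(n : ℝ) ^ ε⌉₊).toOuterMeasure {x | (C n).eval x = false} = 0 := by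
    filter_upwards [hgrow] with n hg
    rw [PMF.toOuterMeasure_apply_eq_zero_iff, Set.disjoint_left]
    intro x hx hxf
    rw [plantedCliqueDist, PMF.support_map] at hx
    obtain ⟨p, hp, rfl⟩ := hx
    obtain ⟨hcard, hcl⟩ := mem_support_plantedCliqueJoint hp
    have hle : t n ≤ p.1.card := by rw [hcard]; exact le_min hg.1 hg.2
    obtain ⟨S, hSsub, hScard⟩ := Finset.exists_subset_card_eq hle
    have hclS : (graphOfEdgeVec p.2).IsClique (S : Set (Fin n)) := hcl.subset (by exact_mod_cast hSsub)
    have htrue : (C n).eval p.2 = true := by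
      rw [hCcomp n hg.2 p.2, cliqueFn_eq_true_iff]
      exact fun hfree => hfree S ⟨hclS, hScard⟩
    simp only [Set.mem_setOf_eq] at hxf
    rw [htrue] at hxf
    exact Bool.noConfusion hxf
  refine hI.congr' ?_
  filter_upwards [hII] with n hn
  rw [hn, add_zero]

/-- **The size bound is load-bearing**: the crux with the size bound `(C n).size ≤ n ^ c` (and with it `c`)
dropped, everything else as filed, is false (witnessed at `δ = 1/4`). Any proof of `MonotoneBlind` must be
a genuine monotone SIZE lower bound. [folklore] -/
theorem monotoneBlind_false_without_sizeBound :
    ¬ ∀ δ : ℝ, 0 < δ → δ < 1 / 2 → ¬ ∃ C : (n : ℕ) → Circuit ((⊤ : SimpleGraph (Fin n)).edgeSet),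
      (∀ᶠ n : ℕ in atTop, (C n).IsOver monotoneBasis01) ∧
        Tendsto (fun n : ℕ => (erdosRenyiHalf n).toOuterMeasure {x | (C n).eval x = true} +
          (plantedCliqueDist n ⌈(n : ℝ) ^ (1 / 2 - δ)⌉₊).toOuterMeasure {x | (C n).eval x = false})
          atTop (nhds 0) := by
  intro h
  obtain ⟨C, hC, -, hT⟩ := exists_monotone_strongDetector (ε := 1 / 2 - 1 / 4) (by norm_num) (by norm_num)
  exact h (1 / 4) (by norm_num) (by norm_num) ⟨C, Eventually.of_forall hC, hT⟩

/-- Sharper: the size-free variant fails at EVERY admissible `δ`, not only at one. [folklore] -/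
theorem withoutSizeBound_fails_everywhere (δ : ℝ) (hδ : 0 < δ) (hδ' : δ < 1 / 2) :
    ∃ C : (n : ℕ) → Circuit ((⊤ : SimpleGraph (Fin n)).edgeSet),
      (∀ᶠ n : ℕ in atTop, (C n).IsOver monotoneBasis01) ∧
        Tendsto (fun n : ℕ => (erdosRenyiHalf n).toOuterMeasure {x | (C n).eval x = true} +
          (plantedCliqueDist n ⌈(n : ℝ) ^ (1 / 2 - δ)⌉₊).toOuterMeasure {x | (C n).eval x = false})
          atTop (nhds 0) := by
  obtain ⟨C, hC, -, hT⟩ := exists_monotone_strongDetector (ε := 1 / 2 - δ) (by linarith) (by linarith)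
  exact ⟨C, Eventually.of_forall hC, hT⟩

/-! ## §2 The error clause is load-bearing (non-vacuity of the size/basis constraint) -/

/-- **The error clause is load-bearing**: the crux with the error clause dropped ("no monotone family of
size `≤ n^c` eventually exists at all") is false — the constant-`0` family meets the size/basis constraint
for every `c` (size `1 ≤ n^c` for `n ≥ 1`); only the error clause excludes it. [folklore] -/
theorem monotoneBlind_false_without_errorClause :
    ¬ ∀ δ : ℝ, 0 < δ → δ < 1 / 2 → ∀ c : ℕ, ¬ ∃ C : (n : ℕ) → Circuit ((⊤ : SimpleGraph (Fin n)).edgeSet),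
      ∀ᶠ n : ℕ in atTop, (C n).IsOver monotoneBasis01 ∧ (C n).size ≤ n ^ c := by
  intro h
  refine h (1 / 4) (by norm_num) (by norm_num) 0 ⟨fun n => Circuit.const _ false, ?_⟩
  filter_upwards [eventually_ge_atTop 1] with n hn
  refine ⟨?_, by simp⟩
  intro g hg
  simp only [Circuit.const, List.mem_singleton] at hg
  subst hg
  exact Set.mem_insert_of_mem _ (Set.mem_insert _ _)

/-- The error sum of the constant-`0` family is identically `1` (it never accepts): meeting the size/basis
constraint is worthless on its own. [folklore] -/
theorem errSum_const_false (n k : ℕ) :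
    (erdosRenyiHalf n).toOuterMeasure
        {x | (Circuit.const ((⊤ : SimpleGraph (Fin n)).edgeSet) false).eval x = true} +
      (plantedCliqueDist n k).toOuterMeasure
        {x | (Circuit.const ((⊤ : SimpleGraph (Fin n)).edgeSet) false).eval x = false} = 1 := by
  have h1 : {x : (⊤ : SimpleGraph (Fin n)).edgeSet → Bool |
      (Circuit.const ((⊤ : SimpleGraph (Fin n)).edgeSet) false).eval x = true} = ∅ := by
    ext; simp
  have h2 : {x : (⊤ : SimpleGraph (Fin n)).edgeSet → Bool |
      (Circuit.const ((⊤ : SimpleGraph (Fin n)).edgeSet) false).eval x = false} = Set.univ := by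
    ext; simp
  rw [h1, h2, MeasureTheory.measure_empty, zero_add]
  exact (PMF.toOuterMeasure_apply_eq_one_iff _ _).2 (Set.subset_univ _)

/-- Dually, the constant-`1` family has error sum identically `1` (it never rejects). [folklore] -/
theorem errSum_const_true (n k : ℕ) :
    (erdosRenyiHalf n).toOuterMeasure
        {x | (Circuit.const ((⊤ : SimpleGraph (Fin n)).edgeSet) true).eval x = true} +
      (plantedCliqueDist n k).toOuterMeasure
        {x | (Circuit.const ((⊤ : SimpleGraph (Fin n)).edgeSet) true).eval x = false} = 1 := by
  have h1 : {x : (⊤ : SimpleGraph (Fin n)).edgeSet → Bool |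
      (Circuit.const ((⊤ : SimpleGraph (Fin n)).edgeSet) true).eval x = true} = Set.univ := by
    ext; simp
  have h2 : {x : (⊤ : SimpleGraph (Fin n)).edgeSet → Bool |
      (Circuit.const ((⊤ : SimpleGraph (Fin n)).edgeSet) true).eval x = false} = ∅ := by
    ext; simp
  rw [h1, h2, MeasureTheory.measure_empty, add_zero]
  exact (PMF.toOuterMeasure_apply_eq_one_iff _ _).2 (Set.subset_univ _)

end Summit.PneNP.PneNP.Theorems.MonotoneBlind.Negative
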